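import Literature.Geometry.DiscreteGeometry.HeitmannRadinBoundaryCount
import HarnessLib

/-!
# Heitmann–Radin 1980: the defects of a sticky-disc ground state are exactly its boundary discs

Topic `Literature/Geometry/DiscreteGeometry`; sequel to `HeitmannRadinBoundaryCount.lean`
((2)(b): a maximal configuration of `n ≥ 3` unit discs has exactly `⌈√(12n-3)⌉ - 3` boundary
discs) and `HeitmannRadinStructure.lean` ((2)(a): every corner of a maximal configuration is
tight or outer). Two items of [HeitmannRadin1980] are added here.

* **Equation (5), p. 285** — "By a 'vertex of type `j`' we mean a point in `C_v` contained in
  exactly `j` bonds, and we let `k_j` be the number of vertices of type `j` in `∂C_g`. Then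
  `a = k₂ + k₃ + k₄ + k₅` (5)": every BOUNDARY disc touches at most five others. The tree's
  (Euler-free) proof of Harborth's bound and of Theorem (2) only uses the summed angle
  inequality `∑_∂ deg ≤ 4a - 6` (`sum_card_nbrs_bdry_le`), never (5) itself. We prove (5) for
  every hard configuration in which each disc touches at least two others (the setting in which
  the boundary walk `Harborth.bdry` is defined): the OUTER corner of the counter-clockwise
  boundary walk at a boundary disc is never tight (`gapAngle_bdry_ne`) — a tight corner closes
  into a unit triangle traced by the face map with all three corners tight
  (`UnitDiscFanCycle.gapAngle_iterate_ne_of_ne`), whereas the walk's corner below the lowest disc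
  is wider than `π` (`pi_lt_gapAngle_bdry_zero`) — so a boundary disc has a corner wider than
  `π/3` and hence at most five neighbours (`card_nbrs_bdry_le_five`,
  `card_nbrs_le_five_of_mem_bdrySet`).
* **Corollary of Theorem (2)(a)–(b), p. 284** (the "defect count" of a two-dimensional sticky
  ground state). In a maximal configuration every interior disc touches exactly six others
  (`card_nbrs_eq_six_of_tight`, from (2)(a)), and by (5) no boundary disc does; so the discs
  with fewer than six contacts are EXACTLY the boundary discs
  (`filter_card_nbrs_lt_six_eq_bdrySet`) and, by (2)(b), their number is `⌈√(12n-3)⌉ - 3`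
  (`card_filter_card_nbrs_lt_six`; the six-coordinated discs number `n + 3 - ⌈√(12n-3)⌉`,
  `card_filter_card_nbrs_eq_six`). In the labelled rendering of `UnitDiscContactNumber.lean`
  (`x : Fin N → EuclideanSpace ℝ (Fin 2)`, `IsMaximalDiscConfig`; the coordination number of
  disc `i` written as the cardinality of `{j ≠ i | dist (x i) (x j) = 1}`, literally the
  expression used for sticky spheres elsewhere in the tree): for every ground state of `N ≥ 3`
  sticky discs the number of discs whose coordination number is not six is exactly
  `⌈√(12N-3)⌉ - 3` (`IsMaximalDiscConfig.card_filter_coordination_ne_six`), and for every `N`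
  it is at most `2√3 · √N` (`IsMaximalDiscConfig.card_filter_coordination_ne_six_le`). This is
  the two-dimensional model — with EQUALITY and the sharp constant `√12` — of statements of the
  shape "in a sticky ground state of `N` hard spheres all but `K · N^{(d-1)/d}` balls have a
  close-packed first coordination shell".
* **The planar close-packed shell** [Harborth1974, (2): "the angle between two bonds at a disc
  is at least `π/3`"]: a disc touching six others has all six corners tight, so its neighbours
  are the vertices `v + w ζ^j` (`j = 0, …, 5`, `|w| = 1`, `ζ = e^{iπ/3}`) of a regular hexagon
  of unit side (`Harborth.nbrs_eq_hexagon_of_card_eq_six`, `Harborth.norm_hexagon_succ_sub`);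
  labelled: the six contact neighbours of such a disc can be listed cyclically with consecutive
  ones touching (`exists_hexagon_of_coordination_eq_six`). So "coordination number six" and
  "regular-hexagon contact shell" are the same condition.

Everything here is proved; no new facts (D-0026).
[cite: HeitmannRadin1980, (5) p. 285; Theorem (2)(a)–(b) p. 284]
-/

noncomputable section

namespace Literature.Geometry.DiscreteGeometry

namespace Harborth

open Complex Finset
open Literature.Topology.PlaneTopology
open scoped Real

variable {P : Finset ℂ}

section Walk

variable {hne : P.Nonempty} {h2 : ∀ p ∈ P, 2 ≤ (nbrs P p).card}

/-! ## §1 The outer corners of the boundary walk are never tight -/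

/-- **The corner below the lowest disc is wider than `π`.** At the lowest (then leftmost) centre
`v₀ = bdry 0` the walk arrives from the neighbour of greatest argument (`bdry (-1) = lastNbr`)
and leaves along the neighbour of least argument (`bdry 1 = firstNbr`); all bond directions at
`v₀` have argument in `[0, π)`, so the traced counter-clockwise gap is `> π`.
[cite: Harborth1974, p. 14] -/
theorem pi_lt_gapAngle_bdry_zero :
    π < gapAngle P (bdry P hne h2 (-1)) (bdry P hne h2 0) := by
  have hs : succ P (bdry P hne h2 (-1)) (bdry P hne h2 0) = bdry P hne h2 1 := by
    have := bdry_add_two (hne := hne) (h2 := h2) (-1)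
    rw [show (-1 : ℤ) + 2 = 1 by norm_num, show (-1 : ℤ) + 1 = 0 by norm_num] at this
    exact this.symm
  rw [gapAngle, hs, bdry_one, bdry_neg_one, bdry_zero]
  obtain ⟨hf, -⟩ := firstNbr_spec hne (nbrs_lowest_nonempty hne h2)
  obtain ⟨hl, -⟩ := lastNbr_spec hne (nbrs_lowest_nonempty hne h2)
  rw [ccwAngle_lastNbr hne (nbrs_lowest_nonempty hne h2) hf (firstNbr_ne_lastNbr hne h2)]
  have h0 := (arg_sub_lowest_mem hne hf).1
  have hπ := (arg_sub_lowest_mem hne hl).2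
  linarith

/-- The face map advances the boundary walk by one step. [cite: Harborth1974, p. 14] -/
theorem next_bdry (m : ℤ) :
    next P (bdry P hne h2 m, bdry P hne h2 (m + 1)) =
      (bdry P hne h2 (m + 1), bdry P hne h2 (m + 2)) := by
  rw [bdry_add_two]; rfl

/-- Iterating the face map along the boundary walk. [cite: Harborth1974, p. 14] -/
theorem iterate_next_bdry (m : ℤ) (j : ℕ) :
    (next P)^[j] (bdry P hne h2 m, bdry P hne h2 (m + 1)) =
      (bdry P hne h2 (m + j), bdry P hne h2 (m + j + 1)) := by
  induction j with
  | zero => simp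
  | succ j ih =>
    rw [Function.iterate_succ_apply', ih, next_bdry]
    have e1 : m + (j : ℕ) + 1 = m + ((j + 1 : ℕ) : ℤ) := by push_cast; ring
    have e2 : m + (j : ℕ) + 2 = m + ((j + 1 : ℕ) : ℤ) + 1 := by push_cast; ring
    rw [e1, e2]

/-- **The outer corners are never tight.** For every `m`, the corner of the boundary walk at
`bdry m` (after `bdry (m-1)`, i.e. the counter-clockwise gap from `bdry (m-1)` to `bdry (m+1)`)
has angle `≠ π/3`: otherwise every corner along its face walk — in particular the corner below
the lowest disc, of angle `> π` — would be tight (`gapAngle_iterate_ne_of_ne`). Equivalently,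
no interior angle of the boundary polygon equals `5π/3`. [cite: HeitmannRadin1980, (5) p. 285] -/
theorem gapAngle_bdry_ne (hP : IsHard P) (m : ℤ) :
    gapAngle P (bdry P hne h2 (m - 1)) (bdry P hne h2 m) ≠ π / 3 := by
  have hπ := Real.pi_pos
  have hT0 : (0 : ℤ) < period P hne h2 := by exact_mod_cast period_pos (hne := hne) (h2 := h2)
  -- the dart below the lowest disc is wide
  have hd : (bdry P hne h2 (-1), bdry P hne h2 0) ∈ darts P := by
    have := bdry_mem_darts (hne := hne) (h2 := h2) (-1)
    rwa [show (-1 : ℤ) + 1 = 0 by norm_num] at this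
  have hw : gapAngle P (bdry P hne h2 (-1)) (bdry P hne h2 0) ≠ π / 3 := by
    intro h
    have := pi_lt_gapAngle_bdry_zero (hne := hne) (h2 := h2)
    rw [h] at this
    linarith
  -- the dart `(bdry (m-1), bdry m)` is an iterate of it
  set j : ℕ := (m % (period P hne h2 : ℤ)).toNat with hj
  have hjm : (j : ℤ) % (period P hne h2 : ℤ) = m % (period P hne h2 : ℤ) := by
    rw [hj, Int.toNat_of_nonneg (Int.emod_nonneg _ hT0.ne'), Int.emod_emod_of_dvd _ (dvd_refl _)]
  have e0 : bdry P hne h2 (-1 + (j : ℕ)) = bdry P hne h2 (m - 1) := by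
    apply bdry_eq_of_emod_eq
    rw [Int.add_emod, hjm, ← Int.add_emod, show -1 + m = m - 1 by ring]
  have e1 : bdry P hne h2 (-1 + (j : ℕ) + 1) = bdry P hne h2 m := by
    rw [show (-1 : ℤ) + (j : ℕ) + 1 = j by ring]
    exact bdry_eq_of_emod_eq hjm
  have key := gapAngle_iterate_ne_of_ne hP h2 hd hw j
  have it := iterate_next_bdry (hne := hne) (h2 := h2) (-1) j
  rw [show (-1 : ℤ) + 1 = 0 by norm_num] at it
  rw [it] at key
  rw [e0, e1] at key
  exact key

/-- **Heitmann–Radin's (5): a boundary disc touches at most five others** ("`a = k₂ + k₃ + k₄ +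
k₅`": no boundary vertex has type `6`) — its outer corner is wider than `π/3`
(`card_nbrs_le_five_of_ne`). [cite: HeitmannRadin1980, (5) p. 285] -/
theorem card_nbrs_bdry_le_five (hP : IsHard P) (m : ℤ) : (nbrs P (bdry P hne h2 m)).card ≤ 5 :=
  card_nbrs_le_five_of_ne hP (bdry_pred_mem_nbrs m) (gapAngle_bdry_ne hP m)

/-- **Heitmann–Radin's (5)**, boundary-set form: every disc of the boundary set `bdrySet`
(the vertex set `C_v ∩ ∂C_g` of the boundary polygon) touches at most five others.
[cite: HeitmannRadin1980, (5) p. 285] -/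
theorem card_nbrs_le_five_of_mem_bdrySet (hP : IsHard P) {v : ℂ} (hv : v ∈ bdrySet P hne h2) :
    (nbrs P v).card ≤ 5 := by
  obtain ⟨m, -, rfl⟩ := Finset.mem_image.1 hv
  exact card_nbrs_bdry_le_five hP (m : ℤ)

end Walk

/-! ## §2 In a ground state the under-coordinated discs are exactly the boundary discs -/

section Maximal

variable {hne : P.Nonempty} {h2 : ∀ p ∈ P, 2 ≤ (nbrs P p).card}

/-- **The defects of a maximal configuration are its boundary discs.** In a maximal
configuration of `n ≥ 3` unit discs, a disc touches fewer than six others if and only if it is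
a vertex of the boundary polygon: interior discs have six neighbours (all their corners are
tight, Theorem (2)(a)), boundary discs at most five ((5)).
[cite: HeitmannRadin1980, Theorem (2)(a) p. 284 and (5) p. 285] -/
theorem filter_card_nbrs_lt_six_eq_bdrySet (hP : IsHard P) (h3 : 3 ≤ P.card)
    (hmax : 2 * harborthNumber P.card ≤ ((darts P).card : ℤ)) :
    P.filter (fun v => (nbrs P v).card < 6) = bdrySet P hne h2 := by
  have ht := tight_or_outer_of_maximal P.card P hP rfl h3 hmax hne h2
  ext v
  simp only [Finset.mem_filter]
  constructor
  · rintro ⟨hv, hlt⟩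
    by_contra hvS
    have := card_nbrs_eq_six_of_tight (hne := hne) (h2 := h2) hP ht hv hvS
    omega
  · intro hv
    have := card_nbrs_le_five_of_mem_bdrySet (hne := hne) (h2 := h2) hP hv
    exact ⟨bdrySet_subset hv, by omega⟩

end Maximal

/-- **The defect count of a two-dimensional sticky ground state.** A maximal configuration of
`n ≥ 3` unit discs (a hard configuration with at least — hence exactly — `[3n - √(12n-3)]`
contact pairs) has exactly `⌈√(12n-3)⌉ - 3` discs touching fewer than six others (namely its
boundary discs, Theorem (2)(b)). [cite: HeitmannRadin1980, Theorem (2)(b) p. 284 and (5) p. 285] -/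
theorem card_filter_card_nbrs_lt_six (hP : IsHard P) (h3 : 3 ≤ P.card)
    (hmax : 2 * harborthNumber P.card ≤ ((darts P).card : ℤ)) :
    (((P.filter fun v => (nbrs P v).card < 6).card : ℕ) : ℤ) = ⌈Real.sqrt (12 * P.card - 3)⌉ - 3 := by
  have hns := not_splits_of_maximal hP hmax
  have hne : P.Nonempty := Finset.card_pos.1 (by omega)
  have h2 : ∀ p ∈ P, 2 ≤ (nbrs P p).card := fun p hp => two_le_card_nbrs_of_not_splits h3 hns hp
  rw [filter_card_nbrs_lt_six_eq_bdrySet (hne := hne) (h2 := h2) hP h3 hmax]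
  exact card_bdrySet_of_maximal hP h3 hmax

/-- **The bulk of a two-dimensional sticky ground state**: a maximal configuration of `n ≥ 3`
unit discs has exactly `n + 3 - ⌈√(12n-3)⌉` discs touching exactly six others (every disc
touches at most six, `card_nbrs_le_six`). [cite: HeitmannRadin1980, Theorem (2)(a)–(b) p. 284] -/
theorem card_filter_card_nbrs_eq_six (hP : IsHard P) (h3 : 3 ≤ P.card)
    (hmax : 2 * harborthNumber P.card ≤ ((darts P).card : ℤ)) :
    (((P.filter fun v => (nbrs P v).card = 6).card : ℕ) : ℤ) =
      P.card + 3 - ⌈Real.sqrt (12 * P.card - 3)⌉ := by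
  have hlt := card_filter_card_nbrs_lt_six hP h3 hmax
  have heq : P.filter (fun v => ¬ (nbrs P v).card < 6) = P.filter (fun v => (nbrs P v).card = 6) :=
    Finset.filter_congr fun v _ => by have := card_nbrs_le_six hP v; omega
  have hsum : (P.filter fun v => (nbrs P v).card < 6).card +
      (P.filter fun v => (nbrs P v).card = 6).card = P.card := by
    have h := Finset.card_filter_add_card_filter_not
      (s := P) (fun v => (nbrs P v).card < 6)
    simpa only [heq] using h
  have hsum' : (((P.filter fun v => (nbrs P v).card < 6).card : ℕ) : ℤ) +
      (((P.filter fun v => (nbrs P v).card = 6).card : ℕ) : ℤ) = P.card := by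
    exact_mod_cast hsum
  omega

/-! ## §3 A six-coordinated disc has a regular-hexagon contact shell -/

/-- **Six neighbours form a regular hexagon** (the planar kissing configuration is rigid). If a
disc of a hard configuration touches six others, then every corner at its centre `v` is tight
(the six gaps are `≥ π/3` and sum to `2π`) and its neighbours are exactly the six points
`v + w ζ^j`, `j = 0, …, 5` (`ζ = e^{iπ/3}`), for a unit vector `w`: the contact shell of a
six-coordinated disc is a regular hexagon of unit side — the planar "close-packed shell".
[cite: Harborth1974, (2)] -/
theorem nbrs_eq_hexagon_of_card_eq_six (hP : IsHard P) {v : ℂ} (h6 : (nbrs P v).card = 6) :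
    ∃ w : ℂ, ‖w‖ = 1 ∧
      nbrs P v = (Finset.range 6).image
        fun j => v + w * Complex.exp (((π / 3 : ℝ) : ℂ) * I) ^ j := by
  classical
  have hπ := Real.pi_pos
  have h2 : 2 ≤ (nbrs P v).card := by omega
  obtain ⟨q, hq⟩ : (nbrs P v).Nonempty := Finset.card_pos.1 (by omega)
  -- all six corners at `v` are tight
  have ht : ∀ k ∈ nbrs P v, gapAngle P k v = π / 3 := by
    intro k hk
    have hle := gapAngle_add_le hP hk h2
    rw [h6] at hle
    have hge := (gapAngle_mem hP hk h2).1
    push_cast at hle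
    linarith
  set w := succ P q v - v with hw
  have hw1 : ‖w‖ = 1 := norm_sub_eq_one_of_mem_nbrs (succ_mem_nbrs hq)
  have hpow := exists_pow_eq_of_tight hq (fun k hk _ => ht k hk)
  refine ⟨w, hw1, Finset.eq_of_subset_of_card_le (fun k hk => ?_) ?_⟩
  · -- every neighbour is `v + w ζ^j` with `j < 6` (`ζ⁶ = 1`)
    obtain ⟨j, hj⟩ := hpow k hk
    have hζj : Complex.exp (((π / 3 : ℝ) : ℂ) * I) ^ j =
        Complex.exp (((π / 3 : ℝ) : ℂ) * I) ^ (j % 6) := by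
      conv_lhs => rw [← Nat.mod_add_div j 6]
      rw [pow_add, pow_mul, exp_pi_div_three_mul_I_pow_six, one_pow, mul_one]
    refine Finset.mem_image.2 ⟨j % 6, Finset.mem_range.2 (Nat.mod_lt _ (by norm_num)), ?_⟩
    rw [← hζj]
    linear_combination (-1 : ℂ) * hj
  · exact Finset.card_image_le.trans (by simp [h6])

/-- Consecutive vertices of the hexagon `v + w ζ^j` touch each other (`|ζ - 1| = 1`): the
contact shell of a six-coordinated disc is a closed chain of six contacts. [cite: Harborth1974, (2)] -/
theorem norm_hexagon_succ_sub {v w : ℂ} (hw : ‖w‖ = 1) (j : ℕ) :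
    ‖(v + w * Complex.exp (((π / 3 : ℝ) : ℂ) * I) ^ (j + 1)) -
        (v + w * Complex.exp (((π / 3 : ℝ) : ℂ) * I) ^ j)‖ = 1 := by
  have e : (v + w * Complex.exp (((π / 3 : ℝ) : ℂ) * I) ^ (j + 1)) -
      (v + w * Complex.exp (((π / 3 : ℝ) : ℂ) * I) ^ j) =
      w * Complex.exp (((π / 3 : ℝ) : ℂ) * I) ^ j * (Complex.exp (((π / 3 : ℝ) : ℂ) * I) - 1) := by
    ring
  rw [e, norm_mul, norm_mul, norm_pow, hw, norm_exp_pi_div_three_mul_I, one_pow,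
    norm_exp_pi_div_three_mul_I_sub_one]
  norm_num

end Harborth

/-! ## §4 The labelled rendering: coordination numbers of a ground state of `N` sticky discs -/

section Labelled

open Finset
open Literature.MathematicalPhysics.StatisticalMechanics
open scoped Real

/-- **Transfer to the centre set.** For a hard labelled configuration `x : Fin N → ℝ²`, moved to
`ℂ` along the isometry `ℝ² ≅ ℂ`, the centre set `P` is a hard `N`-point configuration carrying
at least `2 · contactPairCount x` darts, and the coordination number of disc `i` (the number of
`j ≠ i` with `dist (x i) (x j) = 1`) is the number of neighbours of its centre in `P`.
[cite: HeitmannRadin1980, §2 (p. 283)] -/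
theorem exists_centreSet_model {N : ℕ} (x : Fin N → EuclideanSpace ℝ (Fin 2))
    (hx : Pairwise fun i j => 1 ≤ dist (x i) (x j)) :
    ∃ (y : Fin N → ℂ) (P : Finset ℂ), Function.Injective y ∧ P = Finset.univ.image y ∧
      P.card = N ∧ Harborth.IsHard P ∧ 2 * contactPairCount x ≤ (Harborth.darts P).card ∧
      ∀ i, (Harborth.nbrs P (y i)).card =
        (Finset.univ.filter fun j : Fin N => j ≠ i ∧ dist (x i) (x j) = 1).card := by
  classical
  -- move to `ℂ`
  let e : EuclideanSpace ℝ (Fin 2) ≃ₗᵢ[ℝ] ℂ := Complex.orthonormalBasisOneI.repr.symm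
  let y : Fin N → ℂ := fun i => e (x i)
  have hdist : ∀ i j, dist (y i) (y j) = dist (x i) (x j) := fun i j => e.dist_map (x i) (x j)
  have hyinj : Function.Injective y := by
    intro i j h
    by_contra hij
    have h1 : 1 ≤ dist (x i) (x j) := hx hij
    rw [← hdist, h, dist_self] at h1
    exact absurd h1 (by norm_num)
  let P : Finset ℂ := Finset.univ.image y
  have hmem : ∀ i, y i ∈ P := fun i => Finset.mem_image_of_mem y (Finset.mem_univ i)
  have hcard : P.card = N := by
    rw [Finset.card_image_of_injective _ hyinj, Finset.card_univ, Fintype.card_fin]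
  have hhard : Harborth.IsHard P := by
    intro p hp q hq hpq
    obtain ⟨i, -, rfl⟩ := Finset.mem_image.1 hp
    obtain ⟨j, -, rfl⟩ := Finset.mem_image.1 hq
    have hij : j ≠ i := fun h => hpq (by rw [h])
    rw [← dist_eq_norm, hdist]
    exact hx hij
  -- the centre set carries `2 · contactPairCount x` darts
  set A := Finset.univ.filter fun p : Fin N × Fin N => p.1 < p.2 ∧ dist (x p.1) (x p.2) = 1
    with hA
  have hAc : A.card = contactPairCount x := rfl
  let f : Fin N × Fin N → ℂ × ℂ := fun ij => (y ij.1, y ij.2)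
  have hfinj : Function.Injective f := by
    intro a b h
    have h' := Prod.mk.inj h
    exact Prod.ext (hyinj h'.1) (hyinj h'.2)
  have hdisj : Disjoint A (A.image Prod.swap) := by
    rw [Finset.disjoint_left]
    intro p hp hp'
    obtain ⟨q, hq, hqp⟩ := Finset.mem_image.1 hp'
    rw [hA, Finset.mem_filter] at hp hq
    rw [← hqp, Prod.fst_swap, Prod.snd_swap] at hp
    exact lt_asymm hp.2.1 hq.2.1
  have hsub : (A ∪ A.image Prod.swap).image f ⊆ Harborth.darts P := by
    intro d hd
    obtain ⟨p, hp, rfl⟩ := Finset.mem_image.1 hd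
    have h1 : dist (x p.1) (x p.2) = 1 := by
      rcases Finset.mem_union.1 hp with h | h
      · exact (Finset.mem_filter.1 h).2.2
      · obtain ⟨q, hq, rfl⟩ := Finset.mem_image.1 h
        rw [Prod.fst_swap, Prod.snd_swap, dist_comm]
        exact (Finset.mem_filter.1 hq).2.2
    refine Harborth.mem_darts.2 ⟨⟨hmem _, hmem _⟩, ?_⟩
    change ‖y p.2 - y p.1‖ = 1
    rw [← dist_eq_norm, hdist, dist_comm, h1]
  have h2c : 2 * contactPairCount x ≤ (Harborth.darts P).card := by
    calc 2 * contactPairCount x = (A ∪ A.image Prod.swap).card := by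
          rw [Finset.card_union_of_disjoint hdisj,
            Finset.card_image_of_injective _ Prod.swap_injective, hAc]
          ring
      _ = ((A ∪ A.image Prod.swap).image f).card := (Finset.card_image_of_injective _ hfinj).symm
      _ ≤ (Harborth.darts P).card := Finset.card_le_card hsub
  -- coordination numbers are neighbour counts
  have hnbrs : ∀ i, Harborth.nbrs P (y i) =
      (Finset.univ.filter fun j : Fin N => j ≠ i ∧ dist (x i) (x j) = 1).image y := by
    intro i
    ext q
    rw [Harborth.mem_nbrs]
    constructor
    · rintro ⟨hq, hq1⟩
      obtain ⟨j, -, rfl⟩ := Finset.mem_image.1 hq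
      refine Finset.mem_image.2 ⟨j, Finset.mem_filter.2 ⟨Finset.mem_univ _, ?_, ?_⟩, rfl⟩
      · rintro rfl
        rw [sub_self, norm_zero] at hq1
        exact zero_ne_one hq1
      · rw [← hdist, dist_comm, dist_eq_norm]; exact hq1
    · intro hq
      obtain ⟨j, hj, rfl⟩ := Finset.mem_image.1 hq
      obtain ⟨-, -, hj1⟩ := Finset.mem_filter.1 hj
      exact ⟨hmem j, by rw [← dist_eq_norm, dist_comm, hdist]; exact hj1⟩
  refine ⟨y, P, hyinj, rfl, hcard, hhard, h2c, fun i => ?_⟩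
  rw [hnbrs i, Finset.card_image_of_injective _ hyinj]

/-- **Transfer to the centre set, neighbour form.** For a hard labelled configuration moved to
`ℂ`, the neighbours of the centre `y i` in the centre set are the images of the labels `j ≠ i`
with `dist (x i) (x j) = 1`. [cite: HeitmannRadin1980, §2 (p. 283)] -/
theorem exists_isometry_model {N : ℕ} (x : Fin N → EuclideanSpace ℝ (Fin 2))
    (hx : Pairwise fun i j => 1 ≤ dist (x i) (x j)) :
    ∃ y : Fin N → ℂ, Function.Injective y ∧ (∀ i j, dist (y i) (y j) = dist (x i) (x j)) ∧
      Harborth.IsHard (Finset.univ.image y) ∧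
      ∀ i, Harborth.nbrs (Finset.univ.image y) (y i) =
        (Finset.univ.filter fun j : Fin N => j ≠ i ∧ dist (x i) (x j) = 1).image y := by
  classical
  let e : EuclideanSpace ℝ (Fin 2) ≃ₗᵢ[ℝ] ℂ := Complex.orthonormalBasisOneI.repr.symm
  let y : Fin N → ℂ := fun i => e (x i)
  have hdist : ∀ i j, dist (y i) (y j) = dist (x i) (x j) := fun i j => e.dist_map (x i) (x j)
  have hyinj : Function.Injective y := by
    intro i j h
    by_contra hij
    have h1 : 1 ≤ dist (x i) (x j) := hx hij
    rw [← hdist, h, dist_self] at h1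
    exact absurd h1 (by norm_num)
  have hmem : ∀ i, y i ∈ Finset.univ.image y := fun i =>
    Finset.mem_image_of_mem y (Finset.mem_univ i)
  have hhard : Harborth.IsHard (Finset.univ.image y) := by
    intro p hp q hq hpq
    obtain ⟨i, -, rfl⟩ := Finset.mem_image.1 hp
    obtain ⟨j, -, rfl⟩ := Finset.mem_image.1 hq
    have hij : j ≠ i := fun h => hpq (by rw [h])
    rw [← dist_eq_norm, hdist]
    exact hx hij
  refine ⟨y, hyinj, hdist, hhard, fun i => ?_⟩
  ext q
  rw [Harborth.mem_nbrs]
  constructor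
  · rintro ⟨hq, hq1⟩
    obtain ⟨j, -, rfl⟩ := Finset.mem_image.1 hq
    refine Finset.mem_image.2 ⟨j, Finset.mem_filter.2 ⟨Finset.mem_univ _, ?_, ?_⟩, rfl⟩
    · rintro rfl
      rw [sub_self, norm_zero] at hq1
      exact zero_ne_one hq1
    · rw [← hdist, dist_comm, dist_eq_norm]; exact hq1
  · intro hq
    obtain ⟨j, hj, rfl⟩ := Finset.mem_image.1 hq
    obtain ⟨-, -, hj1⟩ := Finset.mem_filter.1 hj
    exact ⟨hmem j, by rw [← dist_eq_norm, dist_comm, hdist]; exact hj1⟩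

/-- **A six-coordinated disc has a hexagonal contact shell (labelled rendering).** If disc `i` of
a hard configuration touches six others, its contact neighbours can be listed cyclically as
`c 0, c 1, …, c 5` (`c (k + 6) = c k`) with consecutive ones touching: together with
`dist (x i) (x (c k)) = 1` this says that the shell is a regular hexagon of unit side centred at
`x i` (`Harborth.nbrs_eq_hexagon_of_card_eq_six`). [cite: Harborth1974, (2)] -/
theorem exists_hexagon_of_coordination_eq_six {N : ℕ} (x : Fin N → EuclideanSpace ℝ (Fin 2))
    (hx : Pairwise fun i j => 1 ≤ dist (x i) (x j)) (i : Fin N)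
    (h6 : (Finset.univ.filter fun j : Fin N => j ≠ i ∧ dist (x i) (x j) = 1).card = 6) :
    ∃ c : ℕ → Fin N, (∀ k, c (k + 6) = c k) ∧
      (∀ j : Fin N, (j ≠ i ∧ dist (x i) (x j) = 1) ↔ ∃ k < 6, c k = j) ∧
      ∀ k, dist (x (c k)) (x (c (k + 1))) = 1 := by
  classical
  obtain ⟨y, hyinj, hdist, hhard, hnbrs⟩ := exists_isometry_model x hx
  have h6' : (Harborth.nbrs (Finset.univ.image y) (y i)).card = 6 := by
    rw [hnbrs i, Finset.card_image_of_injective _ hyinj]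
    exact h6
  obtain ⟨w, hw1, hhex⟩ := Harborth.nbrs_eq_hexagon_of_card_eq_six hhard h6'
  set ζ := Complex.exp (((π / 3 : ℝ) : ℂ) * Complex.I) with hζ
  have hζ6 : ∀ k : ℕ, ζ ^ (k + 6) = ζ ^ k := fun k => by
    rw [pow_add, hζ, Harborth.exp_pi_div_three_mul_I_pow_six, mul_one]
  have hζmod : ∀ k : ℕ, ζ ^ k = ζ ^ (k % 6) := fun k => by
    conv_lhs => rw [← Nat.mod_add_div k 6]
    rw [pow_add, pow_mul, hζ, Harborth.exp_pi_div_three_mul_I_pow_six, one_pow, mul_one]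
  -- every vertex of the hexagon is a centre `y j` with `j` touching `i`
  have hvert : ∀ k : ℕ, ∃ j : Fin N,
      j ∈ (Finset.univ.filter fun j : Fin N => j ≠ i ∧ dist (x i) (x j) = 1) ∧
        y j = y i + w * ζ ^ k := by
    intro k
    have hk : y i + w * ζ ^ k ∈ Harborth.nbrs (Finset.univ.image y) (y i) := by
      rw [hhex, hζmod k]
      exact Finset.mem_image.2 ⟨k % 6, Finset.mem_range.2 (Nat.mod_lt _ (by norm_num)), rfl⟩
    rw [hnbrs i] at hk
    obtain ⟨j, hj, hjk⟩ := Finset.mem_image.1 hk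
    exact ⟨j, hj, hjk⟩
  choose c hcF hcy using hvert
  refine ⟨c, fun k => ?_, fun j => ?_, fun k => ?_⟩
  · apply hyinj
    rw [hcy, hcy, hζ6]
  · constructor
    · intro hj
      have hjF : j ∈ (Finset.univ.filter fun j : Fin N => j ≠ i ∧ dist (x i) (x j) = 1) :=
        Finset.mem_filter.2 ⟨Finset.mem_univ _, hj⟩
      have hyj : y j ∈ Harborth.nbrs (Finset.univ.image y) (y i) := by
        rw [hnbrs i]; exact Finset.mem_image_of_mem y hjF
      rw [hhex] at hyj
      obtain ⟨k, hk, hky⟩ := Finset.mem_image.1 hyj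
      refine ⟨k, Finset.mem_range.1 hk, hyinj ?_⟩
      rw [hcy]
      exact hky
    · rintro ⟨k, -, rfl⟩
      exact (Finset.mem_filter.1 (hcF k)).2
  · rw [← hdist, dist_eq_norm, hcy, hcy, norm_sub_rev]
    exact Harborth.norm_hexagon_succ_sub hw1 k

/-- **Every disc of a hard configuration touches at most six others** (labelled rendering of
`Harborth.card_nbrs_le_six`). [cite: Harborth1974, (2)] -/
theorem card_filter_dist_eq_one_le_six {N : ℕ} (x : Fin N → EuclideanSpace ℝ (Fin 2))
    (hx : Pairwise fun i j => 1 ≤ dist (x i) (x j)) (i : Fin N) :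
    (Finset.univ.filter fun j : Fin N => j ≠ i ∧ dist (x i) (x j) = 1).card ≤ 6 := by
  obtain ⟨y, P, -, -, -, hhard, -, hdeg⟩ := exists_centreSet_model x hx
  rw [← hdeg i]
  exact Harborth.card_nbrs_le_six hhard (y i)

/-- **Heitmann–Radin 1980, defect count of a ground state (labelled rendering).** For every
ground state `x` of `N ≥ 3` sticky discs (a maximal configuration, `IsMaximalDiscConfig`), the
number of discs whose coordination number — the number of `j ≠ i` with `dist (x i) (x j) = 1` —
is less than six is exactly `⌈√(12N - 3)⌉ - 3`: they are the boundary discs of Theorem (2)(b),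
every other disc being a lattice point with all six lattice neighbours present (Theorem (2)(a))
and no boundary disc having type six ((5)).
[cite: HeitmannRadin1980, Theorem (2)(a)–(b) p. 284 and (5) p. 285] -/
theorem IsMaximalDiscConfig.card_filter_coordination_lt_six {N : ℕ} (hN : 3 ≤ N)
    {x : Fin N → EuclideanSpace ℝ (Fin 2)} (hx : IsMaximalDiscConfig x) :
    (((Finset.univ.filter fun i : Fin N =>
        (Finset.univ.filter fun j : Fin N => j ≠ i ∧ dist (x i) (x j) = 1).card < 6).card : ℕ) : ℤ) =
      ⌈Real.sqrt (12 * N - 3)⌉ - 3 := by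
  classical
  obtain ⟨hxhard, hxmax⟩ := hx
  obtain ⟨y, P, hyinj, hP, hcard, hhard, h2c, hdeg⟩ := exists_centreSet_model x hxhard
  -- maximality: Harborth's construction has `[3N - √(12N-3)]` contacts, so `x` has at least as many
  obtain ⟨w, hw, hwN⟩ := exists_contactPairCount_eq_harborthNumber N
  have hge : harborthNumber N ≤ contactPairCount x := by
    rw [← hwN]; exact_mod_cast hxmax w hw
  have hmax : 2 * harborthNumber P.card ≤ ((Harborth.darts P).card : ℤ) := by
    rw [hcard]
    have : ((2 * contactPairCount x : ℕ) : ℤ) ≤ (Harborth.darts P).card := by exact_mod_cast h2c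
    push_cast at this
    linarith
  have h3 : 3 ≤ P.card := hcard ▸ hN
  -- the under-coordinated discs are the under-coordinated centres
  have hset : P.filter (fun v => (Harborth.nbrs P v).card < 6) =
      (Finset.univ.filter fun i : Fin N =>
        (Finset.univ.filter fun j : Fin N => j ≠ i ∧ dist (x i) (x j) = 1).card < 6).image y := by
    ext v
    rw [Finset.mem_filter]
    constructor
    · rintro ⟨hv, hlt⟩
      rw [hP] at hv
      obtain ⟨i, -, rfl⟩ := Finset.mem_image.1 hv
      refine Finset.mem_image.2 ⟨i, Finset.mem_filter.2 ⟨Finset.mem_univ _, ?_⟩, rfl⟩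
      rwa [← hdeg i]
    · intro hv
      obtain ⟨i, hi, rfl⟩ := Finset.mem_image.1 hv
      refine ⟨hP ▸ Finset.mem_image_of_mem y (Finset.mem_univ i), ?_⟩
      rw [hdeg i]
      exact (Finset.mem_filter.1 hi).2
  have := Harborth.card_filter_card_nbrs_lt_six hhard h3 hmax
  rw [hset, Finset.card_image_of_injective _ hyinj, hcard] at this
  exact this

/-- **Defect count, "not six" form.** For a ground state of `N ≥ 3` sticky discs the number of
discs whose coordination number is NOT six equals `⌈√(12N - 3)⌉ - 3` (coordination numbers
never exceed six). [cite: HeitmannRadin1980, Theorem (2)(a)–(b) p. 284 and (5) p. 285] -/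
theorem IsMaximalDiscConfig.card_filter_coordination_ne_six {N : ℕ} (hN : 3 ≤ N)
    {x : Fin N → EuclideanSpace ℝ (Fin 2)} (hx : IsMaximalDiscConfig x) :
    (((Finset.univ.filter fun i : Fin N =>
        (Finset.univ.filter fun j : Fin N => j ≠ i ∧ dist (x i) (x j) = 1).card ≠ 6).card : ℕ) : ℤ) =
      ⌈Real.sqrt (12 * N - 3)⌉ - 3 := by
  obtain ⟨hxhard, -⟩ := id hx
  have hfilter : (Finset.univ.filter fun i : Fin N =>
        (Finset.univ.filter fun j : Fin N => j ≠ i ∧ dist (x i) (x j) = 1).card ≠ 6) =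
      (Finset.univ.filter fun i : Fin N =>
        (Finset.univ.filter fun j : Fin N => j ≠ i ∧ dist (x i) (x j) = 1).card < 6) :=
    Finset.filter_congr fun i _ => by
      have := card_filter_dist_eq_one_le_six x hxhard i
      omega
  rw [hfilter]
  exact hx.card_filter_coordination_lt_six hN

/-- **Bulk crystallization of sticky discs, square-root form.** For every `N` and every ground
state `x` of `N` sticky discs, all but at most `2√3 · √N` discs have coordination number six
(a full hexagonal contact shell): for `N ≥ 3` the exact count `⌈√(12N-3)⌉ - 3` is
`< √(12N - 3) - 2 < √12 · √N`, and for `N ≤ 12` trivially `N ≤ 2√3 √N`.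
[cite: HeitmannRadin1980, Theorem (2)(a)–(b) p. 284 and (5) p. 285] -/
theorem IsMaximalDiscConfig.card_filter_coordination_ne_six_le {N : ℕ}
    {x : Fin N → EuclideanSpace ℝ (Fin 2)} (hx : IsMaximalDiscConfig x) :
    (((Finset.univ.filter fun i : Fin N =>
        (Finset.univ.filter fun j : Fin N => j ≠ i ∧ dist (x i) (x j) = 1).card ≠ 6).card : ℕ) : ℝ) ≤
      2 * Real.sqrt 3 * Real.sqrt N := by
  have hsq : 2 * Real.sqrt 3 * Real.sqrt N = Real.sqrt (12 * N) := by
    rw [show (12 : ℝ) * N = (2 ^ 2 * 3) * N by norm_num,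
      Real.sqrt_mul (show (0 : ℝ) ≤ 2 ^ 2 * 3 by norm_num),
      Real.sqrt_mul (show (0 : ℝ) ≤ 2 ^ 2 by norm_num), Real.sqrt_sq (show (0 : ℝ) ≤ 2 by norm_num)]
  rw [hsq]
  by_cases hN : 3 ≤ N
  · have h := hx.card_filter_coordination_ne_six hN
    have hR : (((Finset.univ.filter fun i : Fin N =>
        (Finset.univ.filter fun j : Fin N => j ≠ i ∧ dist (x i) (x j) = 1).card ≠ 6).card : ℕ) : ℝ) =
        ((⌈Real.sqrt (12 * N - 3)⌉ - 3 : ℤ) : ℝ) := by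
      exact_mod_cast h
    rw [hR]
    push_cast
    have hceil := Int.ceil_lt_add_one (Real.sqrt (12 * N - 3))
    have hmono : Real.sqrt (12 * N - 3) ≤ Real.sqrt (12 * N) := Real.sqrt_le_sqrt (by linarith)
    linarith
  · -- `N ≤ 2`: at most `N ≤ √(12 N)` discs altogether
    push Not at hN
    have hle : (((Finset.univ.filter fun i : Fin N =>
        (Finset.univ.filter fun j : Fin N => j ≠ i ∧ dist (x i) (x j) = 1).card ≠ 6).card : ℕ) : ℝ) ≤
        N := by
      have := Finset.card_le_univ (Finset.univ.filter fun i : Fin N =>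
        (Finset.univ.filter fun j : Fin N => j ≠ i ∧ dist (x i) (x j) = 1).card ≠ 6)
      rw [Fintype.card_fin] at this
      exact_mod_cast this
    have hN' : (N : ℝ) ≤ 2 := by exact_mod_cast (by omega : N ≤ 2)
    have hN0 : (0 : ℝ) ≤ N := Nat.cast_nonneg N
    have hNN : (N : ℝ) ≤ Real.sqrt (12 * N) :=
      calc (N : ℝ) = Real.sqrt (N * N) := (Real.sqrt_mul_self hN0).symm
        _ ≤ Real.sqrt (12 * N) := Real.sqrt_le_sqrt (by nlinarith)
    linarith

end Labelled

end Literature.Geometry.DiscreteGeometry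

end
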